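import Mathlib
import HarnessLib
import Summits.Ventures.LatticeQCDFlow.Exactness.SphereLatticeHMCExact
import Summits.Ventures.LatticeQCDFlow.Exactness.SphereSweepJacobianAE

/-!
# THMC with the Engel–Schaefer checkerboard LO sweep and the exact-geodesic lattice leapfrog is exact — end to end

HONEST FRAMING: exact (Metropolis-corrected) sampling algorithms for lattice gauge theory;
figures of merit are autocorrelation/cost numbers at stated couplings and volumes; no
continuum-physics claim.

Venture `LatticeQCDFlow` (cell pub-lqcd), topic `Exactness`; FANOUT row 7 (`s0-cpn-null`: the
S0-D1 rung — 2D CP⁹, THMC = HMC in the variables of the leading-order trivializing map, run as a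
checkerboard sweep of site kicks, with the exact-geodesic leapfrog).  NEW WORK of the cell,
composing GEN-5's `SphereKickSweep.lean` (`kickSweepEquiv`: the E–S sweep as a measurable
equivalence of `ι → S(V)` with exact Jacobian `sweepJac` for `⊗ μ.toSphere`;
**`kickSweep_thmc_invariant`**: THMC through the sweep is exact for ANY kernel leaving
`(P ∘ F) · sweepJac · ⊗ μ.toSphere` invariant), GEN-6's `SphereLatticeHMCExact.lean`
(**`lattice_sphere_hmc_config_exact`**: the exact-geodesic lattice leapfrog HMC leaves
`e^{−S̃}·uniformSphere^Λ` invariant for EVERY measurable action `S̃`) and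
`SphereSweepJacobianAE.lean` (`ae_sweepJac_pos`: `sweepJac > 0` a.e.).  Nothing is cited as a
fact.  Printed counterpart, NAMED ONLY: Engel–Schaefer, Comput. Phys. Commun. 182 (2011) 2107,
§§2–3.

The one obstacle to composing the two (named NOT CLAIMED in LEAN-GEN5 / LEAN-GEN6): the HMC
theorem produces the weight `e^{−S̃}`, `S̃ = S ∘ F − log sweepJac`; the sweep theorem consumes the
weight `(e^{−S} ∘ F) · sweepJac`; they agree where `sweepJac > 0`, i.e. almost everywhere
(`ae_sweepJac_pos`), so the two weighted measures coincide (`withDensity_congr_ae`); the product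
measures `uniformSphere^Λ` and `toSphere^Λ` differ by the constant `(toSphere univ)^{−|Λ|}`
(`pi_uniformSphere_eq_smul`, `invariant_smul_iff`).

## Content (`E = EuclideanSpace ℝ m`, `dim = card m = n + 2`, `S` its unit sphere, `Λ` finite)

* `pi_uniformSphere_eq_smul`, `two_le_card_of_finrank`.
* **`lattice_sphere_thmc_sweep_exact`** — THE END-TO-END THEOREM: field transformation
  `F = kickSweepEquiv n hV c L₁ L₂` (checkerboard sweep of LO site kicks at local fields inside the
  bijectivity range `|c|‖J‖ ≤ 1`); V-variables updated by the lattice HMC — momenta refreshed from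
  `Z⁻¹e^{−T}·Lebesgue^Λ`, `N` exact-geodesic lattice-leapfrog steps with any measurable
  site-coupling force, momentum flip, Metropolis for `H̃ = (S ∘ F − log sweepJac) + T`, momenta
  forgotten — and the state reported through `F`: `e^{−S}·uniformSphere^Λ` is invariant.
* **`lattice_sphere_thmc_sweep_gaussian_exact`** — with `T = Σ_s ‖p_s‖²/2` (the E–S choice;
  normalisation discharged).

NOT CLAIMED: that the code's force equals `−∇S̃` (exactness holds for ANY measurable force — the
force only drives the acceptance); the U(1) link factors of the CP(N−1) action (frozen spectators
of the local fields); tangent-momentum refresh for THMC (the HMC case is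
`SphereLatticeHMCTangential.lean`; the same bookkeeping applies); ergodicity; numbers.
-/

noncomputable section

namespace Summit.Ventures.LatticeQCDFlow.Exactness

open MeasureTheory Measure Metric Set Real ProbabilityTheory InnerProductGeometry
open Summit.Ventures.LatticeQCDFlow.Theory2
open scoped ENNReal InnerProductSpace

/-! ## §6 `uniformSphere^Λ` is a rescaling of `toSphere^Λ` -/

section Rescale

variable {m : Type*} [Fintype m] [Nonempty m] {Λ : Type*} [Fintype Λ]

/-- `⊗_Λ uniformSphere = (toSphere univ)⁻¹^{|Λ|} • ⊗_Λ toSphere`. -/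
theorem pi_uniformSphere_eq_smul :
    (Measure.pi fun _ : Λ => uniformSphere (volume : Measure (EuclideanSpace ℝ m))) =
      (((volume : Measure (EuclideanSpace ℝ m)).toSphere Set.univ)⁻¹ ^ Fintype.card Λ) •
        Measure.pi fun _ : Λ => (volume : Measure (EuclideanSpace ℝ m)).toSphere := by
  refine Measure.pi_eq fun s _ => ?_
  rw [Measure.smul_apply, Measure.pi_pi, smul_eq_mul]
  simp only [uniformSphere, Measure.smul_apply, smul_eq_mul]
  rw [Finset.prod_mul_distrib, Finset.prod_const, Finset.card_univ]

end Rescale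

/-! ## §7 The end-to-end theorem -/

section EndToEnd

variable {m : Type*} [Fintype m] [DecidableEq m] [Nonempty m] {Λ : Type*} [Fintype Λ]
  (n : ℕ) (hV : Module.finrank ℝ (EuclideanSpace ℝ m) = n + 2) (c : ℝ)
  {p q : Λ → Prop} [DecidablePred p] [DecidablePred q]
  (L₁ : SiteLocalField (EuclideanSpace ℝ m) c p) (L₂ : SiteLocalField (EuclideanSpace ℝ m) c q)

omit [DecidableEq m] [Nonempty m] in
/-- `dim = n + 2` gives `card m ≥ 2`. -/
theorem two_le_card_of_finrank (hV : Module.finrank ℝ (EuclideanSpace ℝ m) = n + 2) :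
    2 ≤ Fintype.card m := by
  rw [finrank_euclideanSpace] at hV
  omega

/-- **THMC WITH THE ENGEL–SCHAEFER LO SWEEP IS EXACT — END TO END.**  Field transformation
`F = kickSweepEquiv` (the checkerboard sweep of LO site kicks at the local fields `L₁`, `L₂`,
inside the bijectivity range); V-variables updated by the lattice HMC of `SphereLatticeHMCExact.lean`
— momenta refreshed from `Z⁻¹e^{−T}·Lebesgue^Λ`, `N` exact-geodesic lattice-leapfrog steps with ANY
measurable site-coupling force `Fc`, momentum flip, Metropolis for `H̃ = (S ∘ F − log sweepJac) + T`,
momenta forgotten — and the state REPORTED THROUGH THE SWEEP: the configuration chain leaves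
`e^{−S}·uniformSphere^Λ` invariant. -/
theorem lattice_sphere_thmc_sweep_exact {S : (Λ → (sphere (0 : EuclideanSpace ℝ m) 1)) → ℝ}
    (hS : Measurable S) {T : (Λ → EuclideanSpace ℝ m) → ℝ} (hT : Measurable T)
    {Fc : (Λ → (sphere (0 : EuclideanSpace ℝ m) 1)) → (Λ → EuclideanSpace ℝ m)} (hFc : Measurable Fc)
    (δ : ℝ) (N : ℕ)
    (hZ0 : (Measure.pi fun _ : Λ => (volume : Measure (EuclideanSpace ℝ m))).withDensity
      (fun π' => ENNReal.ofReal (Real.exp (-T π'))) Set.univ ≠ 0)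
    (hZtop : (Measure.pi fun _ : Λ => (volume : Measure (EuclideanSpace ℝ m))).withDensity
      (fun π' => ENNReal.ofReal (Real.exp (-T π'))) Set.univ ≠ ⊤) :
    ProbabilityTheory.Kernel.Invariant
      (conjKernel
        (refreshUpdate
          (involMH ⇑((latticeFlipPerm : Equiv.Perm ((Λ → (sphere (0 : EuclideanSpace ℝ m) 1)) ×
              (Λ → EuclideanSpace ℝ m))) * latticeLeapfrogPerm Fc δ ^ N)
            (measurePreserving_latticeProposal (two_le_card_of_finrank n hV) hFc δ N).measurable
            fun z : (Λ → (sphere (0 : EuclideanSpace ℝ m) 1)) × (Λ → EuclideanSpace ℝ m) =>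
              (S (kickSweepEquiv n hV c L₁ L₂ z.1) -
                Real.log (sweepJac p q (fun a y g => sphereKick c (L₁.J a y) g) (classJac n c L₁)
                  (classJac n c L₂) z.1)) + T z.2)
          (((Measure.pi fun _ : Λ => (volume : Measure (EuclideanSpace ℝ m))).withDensity
              (fun π' => ENNReal.ofReal (Real.exp (-T π'))) Set.univ)⁻¹ •
            (Measure.pi fun _ : Λ => (volume : Measure (EuclideanSpace ℝ m))).withDensity
              fun π' => ENNReal.ofReal (Real.exp (-T π'))))
        (kickSweepEquiv n hV c L₁ L₂))
      ((Measure.pi fun _ : Λ => uniformSphere (volume : Measure (EuclideanSpace ℝ m))).withDensity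
        fun x => ENNReal.ofReal (Real.exp (-S x))) := by
  set Φ := kickSweepEquiv n hV c L₁ L₂ with hΦ
  set ν : Measure (Λ → (sphere (0 : EuclideanSpace ℝ m) 1)) :=
    Measure.pi fun _ : Λ => (volume : Measure (EuclideanSpace ℝ m)).toSphere with hν
  set C : ℝ≥0∞ := ((volume : Measure (EuclideanSpace ℝ m)).toSphere Set.univ)⁻¹ ^ Fintype.card Λ with hC
  have hC0 : C ≠ 0 := pow_ne_zero _ (ENNReal.inv_ne_zero.2 (measure_ne_top _ _))
  have hCtop : C ≠ ⊤ := ENNReal.pow_ne_top (ENNReal.inv_ne_top.2 (toSphere_univ_ne_zero _))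
  have hpi : (Measure.pi fun _ : Λ => uniformSphere (volume : Measure (EuclideanSpace ℝ m))) = C • ν :=
    pi_uniformSphere_eq_smul
  have hsJ := measurable_esSweepJac n c L₁ L₂ hV
  have hSt : Measurable fun U : Λ → (sphere (0 : EuclideanSpace ℝ m) 1) =>
      S (Φ U) - Real.log (sweepJac p q (fun a y g => sphereKick c (L₁.J a y) g) (classJac n c L₁)
        (classJac n c L₂) U) :=
    (hS.comp Φ.measurable).sub (Real.measurable_log.comp hsJ)
  -- (1) the lattice HMC for the pulled-back action is exact on `uniformSphere^Λ`
  have h1 := lattice_sphere_hmc_config_exact (two_le_card_of_finrank n hV) hSt hT hFc δ N hZ0 hZtop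
  -- (2) the same on `toSphere^Λ`, in the weight form `(e^{−S} ∘ F) · sweepJac`
  have hm1 : (Measure.pi fun _ : Λ => uniformSphere (volume : Measure (EuclideanSpace ℝ m))).withDensity
      (fun U : Λ → (sphere (0 : EuclideanSpace ℝ m) 1) => ENNReal.ofReal (Real.exp
        (-(S (Φ U) - Real.log (sweepJac p q (fun a y g => sphereKick c (L₁.J a y) g) (classJac n c L₁)
          (classJac n c L₂) U))))) =
      C • ν.withDensity (fun U : Λ → (sphere (0 : EuclideanSpace ℝ m) 1) => ENNReal.ofReal (Real.exp
        (-(S (Φ U) - Real.log (sweepJac p q (fun a y g => sphereKick c (L₁.J a y) g) (classJac n c L₁)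
          (classJac n c L₂) U))))) := by
    rw [hpi, withDensity_smul_measure]
  rw [hm1, invariant_smul_iff hC0 hCtop] at h1
  have hae : (fun U : Λ → (sphere (0 : EuclideanSpace ℝ m) 1) => ENNReal.ofReal (Real.exp
      (-(S (Φ U) - Real.log (sweepJac p q (fun a y g => sphereKick c (L₁.J a y) g) (classJac n c L₁)
        (classJac n c L₂) U))))) =ᵐ[ν]
      fun U => ENNReal.ofReal (Real.exp (-S (Φ U))) *
        ENNReal.ofReal (sweepJac p q (fun a y g => sphereKick c (L₁.J a y) g) (classJac n c L₁)
          (classJac n c L₂) U) := by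
    filter_upwards [ae_sweepJac_pos n c L₁ L₂ hV (volume : Measure (EuclideanSpace ℝ m))] with U hU
    rw [show -(S (Φ U) - Real.log (sweepJac p q (fun a y g => sphereKick c (L₁.J a y) g)
        (classJac n c L₁) (classJac n c L₂) U)) =
        -S (Φ U) + Real.log (sweepJac p q (fun a y g => sphereKick c (L₁.J a y) g)
          (classJac n c L₁) (classJac n c L₂) U) by ring,
      Real.exp_add, Real.exp_log hU, ENNReal.ofReal_mul (Real.exp_pos _).le]
  rw [withDensity_congr_ae hae] at h1
  -- (3) THMC through the sweep (weight form), then back to `uniformSphere^Λ`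
  have hP : Measurable fun x : Λ → (sphere (0 : EuclideanSpace ℝ m) 1) => ENNReal.ofReal (Real.exp (-S x)) :=
    (Real.measurable_exp.comp hS.neg).ennreal_ofReal
  have h2 := kickSweep_thmc_invariant n hV c L₁ L₂ (volume : Measure (EuclideanSpace ℝ m)) hP h1
  have hm2 : (Measure.pi fun _ : Λ => uniformSphere (volume : Measure (EuclideanSpace ℝ m))).withDensity
      (fun x : Λ → (sphere (0 : EuclideanSpace ℝ m) 1) => ENNReal.ofReal (Real.exp (-S x))) =
      C • ν.withDensity (fun x : Λ → (sphere (0 : EuclideanSpace ℝ m) 1) => ENNReal.ofReal (Real.exp (-S x))) := by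
    rw [hpi, withDensity_smul_measure]
  rw [hm2, invariant_smul_iff hC0 hCtop]
  exact h2

/-- **… with the Gaussian kinetic energy `T = Σ_s ‖p_s‖²/2`** (the E–S choice; normalisation
discharged by `latticeGaussianWeight_univ_ne_zero_ne_top`). -/
theorem lattice_sphere_thmc_sweep_gaussian_exact {S : (Λ → (sphere (0 : EuclideanSpace ℝ m) 1)) → ℝ}
    (hS : Measurable S)
    {Fc : (Λ → (sphere (0 : EuclideanSpace ℝ m) 1)) → (Λ → EuclideanSpace ℝ m)} (hFc : Measurable Fc)
    (δ : ℝ) (N : ℕ) :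
    ProbabilityTheory.Kernel.Invariant
      (conjKernel
        (refreshUpdate
          (involMH ⇑((latticeFlipPerm : Equiv.Perm ((Λ → (sphere (0 : EuclideanSpace ℝ m) 1)) ×
              (Λ → EuclideanSpace ℝ m))) * latticeLeapfrogPerm Fc δ ^ N)
            (measurePreserving_latticeProposal (two_le_card_of_finrank n hV) hFc δ N).measurable
            fun z : (Λ → (sphere (0 : EuclideanSpace ℝ m) 1)) × (Λ → EuclideanSpace ℝ m) =>
              (S (kickSweepEquiv n hV c L₁ L₂ z.1) -
                Real.log (sweepJac p q (fun a y g => sphereKick c (L₁.J a y) g) (classJac n c L₁)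
                  (classJac n c L₂) z.1)) + ∑ s, ‖z.2 s‖ ^ 2 / 2)
          (((Measure.pi fun _ : Λ => (volume : Measure (EuclideanSpace ℝ m))).withDensity
              (fun π' => ENNReal.ofReal (Real.exp (-(∑ s, ‖π' s‖ ^ 2 / 2)))) Set.univ)⁻¹ •
            (Measure.pi fun _ : Λ => (volume : Measure (EuclideanSpace ℝ m))).withDensity
              fun π' => ENNReal.ofReal (Real.exp (-(∑ s, ‖π' s‖ ^ 2 / 2)))))
        (kickSweepEquiv n hV c L₁ L₂))
      ((Measure.pi fun _ : Λ => uniformSphere (volume : Measure (EuclideanSpace ℝ m))).withDensity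
        fun x => ENNReal.ofReal (Real.exp (-S x))) := by
  have hT : Measurable fun π' : Λ → EuclideanSpace ℝ m => ∑ s, ‖π' s‖ ^ 2 / 2 :=
    (continuous_finsetSum _ fun s _ => (((continuous_apply s).norm).pow 2).div_const 2).measurable
  exact lattice_sphere_thmc_sweep_exact n hV c L₁ L₂ hS hT hFc δ N
    latticeGaussianWeight_univ_ne_zero_ne_top.1 latticeGaussianWeight_univ_ne_zero_ne_top.2

end EndToEnd

end Summit.Ventures.LatticeQCDFlow.Exactness

end
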